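import Summits.CriticalPhenomena.PercolationContinuityZ3.Theorems.PercNearOneGluingNoHeavyLowerTailSahiCoSunflowerSeparated
import Mathlib.Tactic.Linarith
import Mathlib.Tactic.Ring
import Mathlib.Tactic.Positivity
import HarnessLib

/-!
# `NoHeavyLowerTail` (crux stmt-CriticalPhenomena-4575), master-family line P1 (gen 13):
# S₃ and Sahi's `C₃` for every co-sunflower whose MAJORITY ("at least two occur") IS AN AND-EVENT (a cylinder `{S ⊇ R}`)

Support file (seat `prim-masterthm-p1`, gen 13; `--supports stmt-CriticalPhenomena-4575`).  Three small definitions (the restricted co-atom groups),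
no `sorry`, standard axioms.  Generalises `coSunflower_nonneg_of_separated` (`…SahiCoSunflowerSeparated`, the case `R = univ`) exactly as
`…SahiCoSunflowerUnionOr` generalises the atom-covering theorem; dual statement.  Memo `…/FROM-prim-masterthm-p1-g13-CP3PLUS.md` §4.

**THEOREM (`coSunflower_nonneg_of_majAnd`).**  Let `G₁,G₂,G₃` be increasing events of the finite cube such that the majority event
`M = (G₁∩G₂)∪(G₁∩G₃)∪(G₂∩G₃)` is CO-GENERATED BY CO-ATOMS: every configuration NOT in `M` lies below a co-atom `{u}ᶜ` not in `M` (equivalently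
`M = {S : S ⊇ R}` is the AND-event of `R` = the coordinates whose co-atom is outside `M`, i.e. lies in at most one `G_i`).  Then with
`A_X = ∏_{u ∈ P_X} p_u` over the restricted co-atom groups (`P_B`: co-atom in `G₂` only, `P_C`: in `G₃` only, `P_A`: the other coordinates of `R`),
`E₃(μ_p; 1_{G₂∪G₃}, 1_{G₁∪G₃}, 1_{G₁∪G₂}) ≥ F_S ≥ A_AA_BA_C(1−A_A)(1−A_B)(1−A_C)(1−A_AA_BA_C) ≥ 0`.
PROOF: a petal point `S ∈ G_i ∖ (G_j ∪ G_k)` contains `R ∖ P_i` (if `u ∈ R`, `u ∉ S`, then `{u}ᶜ ⊇ S` lies in `G_i`, hence — being in at most one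
generator — in `G_i` only, so `u ∈ P_i`), and is not in `M = contain R`; so "only `G_i`" ⊆ `contain(R∖P_i) ∖ contain R`, of mass `A_jA_k − A_AA_BA_C`;
the core is `contain R` of mass `A_AA_BA_C`; transfer into the outside at fixed core (`strongCubic_mono_petals_core`) and `ring`. [this work]
-/

noncomputable section

open scoped Classical

namespace Summit.CriticalPhenomena.PercolationContinuityZ3.Theorems

namespace SahiDeepCore

open Finset
open Literature.Combinatorics.Sahi2008
open Literature.Probability.Percolation.DecisionTree (ind ind_of_mem ind_of_not_mem ind_nonneg)

variable {ι : Type} [Fintype ι]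

local notation3 (prettyPrint := false) "m⟦" p ", " X "⟧" => ex (bernoulliWeight p) (ind X)

/-- `0 ≤ μ_p(X)` (plumbing). [folklore] -/
private theorem m_nn₃ (p : ι → unitInterval) (X : Set (Set ι)) : 0 ≤ m⟦p, X⟧ :=
  ex_nonneg (isFKGMeasure_bernoulliWeight p).nonneg fun ω => ind_nonneg _ ω

/-- `μ_p(Y ∖ X) = μ_p(Y) − μ_p(X)` for `X ⊆ Y` (plumbing). [folklore] -/
private theorem m_sdiff₃ (p : ι → unitInterval) {X Y : Set (Set ι)} (h : X ⊆ Y) : m⟦p, Y \ X⟧ = m⟦p, Y⟧ - m⟦p, X⟧ := by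
  have e : ind Y = ind X + ind (Y \ X) := by
    funext ω
    simp only [Pi.add_apply]
    by_cases hx : ω ∈ X
    · rw [ind_of_mem (h hx), ind_of_mem hx, ind_of_not_mem (fun hh : ω ∈ Y \ X => hh.2 hx), add_zero]
    · by_cases hy : ω ∈ Y
      · rw [ind_of_mem hy, ind_of_not_mem hx, ind_of_mem (show ω ∈ Y \ X from ⟨hy, hx⟩), zero_add]
      · rw [ind_of_not_mem hy, ind_of_not_mem hx, ind_of_not_mem (fun hh : ω ∈ Y \ X => hy hh.1), add_zero]
  have := congrArg (ex (bernoulliWeight p)) e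
  rw [ex_add] at this
  linarith

/-- Monotonicity of `μ_p` (plumbing). [folklore] -/
private theorem m_mono₃ (p : ι → unitInterval) {X Y : Set (Set ι)} (h : X ⊆ Y) : m⟦p, X⟧ ≤ m⟦p, Y⟧ := by
  have := m_sdiff₃ p h
  have h0 := m_nn₃ p (Y \ X)
  linarith

/-- RESTRICTED CO-ATOM GROUP `A`: co-atom `{u}ᶜ` in neither `G₂` nor `G₃` (so in `G₁` only, or in no generator). [this work] -/
def rgrpA (G₂ G₃ : Set (Set ι)) : Finset ι := Finset.univ.filter fun u => ({u}ᶜ : Set ι) ∉ G₂ ∧ ({u}ᶜ : Set ι) ∉ G₃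

/-- RESTRICTED CO-ATOM GROUP `B`: co-atom in `G₂` only. [this work] -/
def rgrpB (G₁ G₂ G₃ : Set (Set ι)) : Finset ι :=
  Finset.univ.filter fun u => ({u}ᶜ : Set ι) ∈ G₂ ∧ ({u}ᶜ : Set ι) ∉ G₁ ∧ ({u}ᶜ : Set ι) ∉ G₃

/-- RESTRICTED CO-ATOM GROUP `C`: co-atom in `G₃` only. [this work] -/
def rgrpC (G₁ G₂ G₃ : Set (Set ι)) : Finset ι :=
  Finset.univ.filter fun u => ({u}ᶜ : Set ι) ∈ G₃ ∧ ({u}ᶜ : Set ι) ∉ G₁ ∧ ({u}ᶜ : Set ι) ∉ G₂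

/-- Membership in the restricted co-atom groups. [this work] -/
theorem mem_rgrp (G₁ G₂ G₃ : Set (Set ι)) (u : ι) :
    (u ∈ rgrpA G₂ G₃ ↔ ({u}ᶜ : Set ι) ∉ G₂ ∧ ({u}ᶜ : Set ι) ∉ G₃) ∧
      (u ∈ rgrpB G₁ G₂ G₃ ↔ ({u}ᶜ : Set ι) ∈ G₂ ∧ ({u}ᶜ : Set ι) ∉ G₁ ∧ ({u}ᶜ : Set ι) ∉ G₃) ∧
      (u ∈ rgrpC G₁ G₂ G₃ ↔ ({u}ᶜ : Set ι) ∈ G₃ ∧ ({u}ᶜ : Set ι) ∉ G₁ ∧ ({u}ᶜ : Set ι) ∉ G₂) := by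
  simp only [rgrpA, rgrpB, rgrpC, Finset.mem_filter, Finset.mem_univ, true_and]

/-- The restricted groups are pairwise disjoint. [this work] -/
theorem rgrp_disjoint (G₁ G₂ G₃ : Set (Set ι)) :
    Disjoint (rgrpA G₂ G₃) (rgrpB G₁ G₂ G₃) ∧ Disjoint (rgrpA G₂ G₃) (rgrpC G₁ G₂ G₃) ∧ Disjoint (rgrpB G₁ G₂ G₃) (rgrpC G₁ G₂ G₃) := by
  have hm := mem_rgrp G₁ G₂ G₃
  refine ⟨?_, ?_, ?_⟩
  · exact Finset.disjoint_left.2 fun u ha hb => ((hm u).1.1 ha).1 ((hm u).2.1.1 hb).1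
  · exact Finset.disjoint_left.2 fun u ha hc => ((hm u).1.1 ha).2 ((hm u).2.2.1 hc).1
  · exact Finset.disjoint_left.2 fun u hb hc => ((hm u).2.1.1 hb).2.2 ((hm u).2.2.1 hc).1

/-- A co-atom lies in at most one generator iff its coordinate is in one of the restricted groups. [this work] -/
theorem mem_rgrp_union_iff (G₁ G₂ G₃ : Set (Set ι)) (u : ι) :
    u ∈ rgrpA G₂ G₃ ∪ rgrpB G₁ G₂ G₃ ∪ rgrpC G₁ G₂ G₃ ↔
      ({u}ᶜ : Set ι) ∉ (G₁ ∩ G₂) ∪ (G₁ ∩ G₃) ∪ (G₂ ∩ G₃) := by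
  have hm := mem_rgrp G₁ G₂ G₃ u
  rw [Finset.mem_union, Finset.mem_union, hm.1, hm.2.1, hm.2.2]
  by_cases g1 : ({u}ᶜ : Set ι) ∈ G₁ <;> by_cases g2 : ({u}ᶜ : Set ι) ∈ G₂ <;> by_cases g3 : ({u}ᶜ : Set ι) ∈ G₃ <;>
    simp [g1, g2, g3]

/-- **THEOREM (S₃ when the majority event is an AND-event).**  If `G₁,G₂,G₃` are increasing and every configuration outside
`M = (G₁∩G₂)∪(G₁∩G₃)∪(G₂∩G₃)` lies below a co-atom outside `M`, then
`F_S(G₂∪G₃, G₁∪G₃, G₁∪G₂) ≥ A_AA_BA_C(1−A_A)(1−A_B)(1−A_C)(1−A_AA_BA_C)` over the restricted co-atom groups. [this work] -/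
theorem strongCubic_ge_of_majAnd (p : ι → unitInterval) {G₁ G₂ G₃ : Set (Set ι)} (h₁ : IsUpperSet G₁) (h₂ : IsUpperSet G₂)
    (h₃ : IsUpperSet G₃)
    (hcogen : ∀ S : Set ι, S ∉ (G₁ ∩ G₂) ∪ (G₁ ∩ G₃) ∪ (G₂ ∩ G₃) →
      ∃ u, u ∉ S ∧ ({u}ᶜ : Set ι) ∉ (G₁ ∩ G₂) ∪ (G₁ ∩ G₃) ∪ (G₂ ∩ G₃)) :
    (∏ u ∈ rgrpA G₂ G₃, (p u : ℝ)) * (∏ u ∈ rgrpB G₁ G₂ G₃, (p u : ℝ)) * (∏ u ∈ rgrpC G₁ G₂ G₃, (p u : ℝ)) *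
        ((1 - ∏ u ∈ rgrpA G₂ G₃, (p u : ℝ)) * (1 - ∏ u ∈ rgrpB G₁ G₂ G₃, (p u : ℝ)) * (1 - ∏ u ∈ rgrpC G₁ G₂ G₃, (p u : ℝ))) *
        (1 - (∏ u ∈ rgrpA G₂ G₃, (p u : ℝ)) * (∏ u ∈ rgrpB G₁ G₂ G₃, (p u : ℝ)) * (∏ u ∈ rgrpC G₁ G₂ G₃, (p u : ℝ))) ≤
      strongCubic p (G₂ ∪ G₃) (G₁ ∪ G₃) (G₁ ∪ G₂) := by
  obtain ⟨e3, e2, e1⟩ := coSunflower_privateParts G₁ G₂ G₃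
  obtain ⟨dAB, dAC, dBC⟩ := rgrp_disjoint G₁ G₂ G₃
  have hm := mem_rgrp G₁ G₂ G₃
  set PA := rgrpA G₂ G₃
  set PB := rgrpB G₁ G₂ G₃
  set PC := rgrpC G₁ G₂ G₃
  set R := PA ∪ PB ∪ PC with hRdef
  set a := ∏ u ∈ PA, (p u : ℝ)
  set b := ∏ u ∈ PB, (p u : ℝ)
  set c := ∏ u ∈ PC, (p u : ℝ)
  -- the majority event is `contain R`
  have hcore : (G₂ ∪ G₃) ∩ (G₁ ∪ G₃) ∩ (G₁ ∪ G₂) = contain R := by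
    ext S
    have maj_iff : S ∈ (G₂ ∪ G₃) ∩ (G₁ ∪ G₃) ∩ (G₁ ∪ G₂) ↔ S ∈ (G₁ ∩ G₂) ∪ (G₁ ∩ G₃) ∪ (G₂ ∩ G₃) := by
      simp only [Set.mem_inter_iff, Set.mem_union]; tauto
    rw [maj_iff]
    constructor
    · intro hS u hu
      by_contra huS
      have hc : ({u}ᶜ : Set ι) ∈ (G₁ ∩ G₂) ∪ (G₁ ∩ G₃) ∪ (G₂ ∩ G₃) := by
        rcases hS with (⟨a1, a2⟩ | ⟨a1, a3⟩) | ⟨a2, a3⟩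
        · exact Or.inl (Or.inl ⟨coatom_mem_of_notMem h₁ a1 huS, coatom_mem_of_notMem h₂ a2 huS⟩)
        · exact Or.inl (Or.inr ⟨coatom_mem_of_notMem h₁ a1 huS, coatom_mem_of_notMem h₃ a3 huS⟩)
        · exact Or.inr ⟨coatom_mem_of_notMem h₂ a2 huS, coatom_mem_of_notMem h₃ a3 huS⟩
      exact (mem_rgrp_union_iff G₁ G₂ G₃ u).1 (Finset.mem_coe.1 hu) hc
    · intro hS
      by_contra hnot
      obtain ⟨u, huS, hu⟩ := hcogen S hnot
      exact huS (hS (Finset.mem_coe.2 ((mem_rgrp_union_iff G₁ G₂ G₃ u).2 hu)))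
  have hprodR : ∏ u ∈ R, (p u : ℝ) = a * b * c := by
    rw [hRdef, Finset.prod_union (Finset.disjoint_union_left.2 ⟨dAC, dBC⟩), Finset.prod_union dAB]
  have hk : m⟦p, (G₂ ∪ G₃) ∩ (G₁ ∪ G₃) ∩ (G₁ ∪ G₂)⟧ = a * b * c := by rw [hcore, m_contain, hprodR]
  -- petal points are not in the majority event `contain R`
  have notcore : ∀ S : Set ι, S ∉ (G₁ ∩ G₂) ∪ (G₁ ∩ G₃) ∪ (G₂ ∩ G₃) → S ∉ contain R := by
    intro S hS hc
    have : S ∈ (G₂ ∪ G₃) ∩ (G₁ ∪ G₃) ∩ (G₁ ∪ G₂) := by rw [hcore]; exact hc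
    apply hS
    simp only [Set.mem_inter_iff, Set.mem_union] at this ⊢; tauto
  -- the key step: an only-`G_i` point contains `R ∖ P_i`
  have pet1 : (G₂ ∪ G₃) \ (G₁ ∪ G₃) ⊆ contain (PA ∪ PC) \ contain R := by
    rw [e2]
    intro S hS
    have hS2 : S ∈ G₂ := hS.1
    have hS1 : S ∉ G₁ := fun h => hS.2 (Or.inl h)
    have hS3 : S ∉ G₃ := fun h => hS.2 (Or.inr h)
    refine ⟨?_, notcore S ?_⟩
    · intro u hu
      by_contra huS
      have c2 := coatom_mem_of_notMem h₂ hS2 huS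
      rcases Finset.mem_union.1 (Finset.mem_coe.1 hu) with h | h
      · exact ((hm u).1.1 h).1 c2
      · exact ((hm u).2.2.1 h).2.2 c2
    · simp only [Set.mem_union, Set.mem_inter_iff]; tauto
  have pet2 : (G₁ ∪ G₃) \ (G₂ ∪ G₃) ⊆ contain (PB ∪ PC) \ contain R := by
    rw [e1]
    intro S hS
    have hS1 : S ∈ G₁ := hS.1
    have hS2 : S ∉ G₂ := fun h => hS.2 (Or.inl h)
    have hS3 : S ∉ G₃ := fun h => hS.2 (Or.inr h)
    refine ⟨?_, notcore S ?_⟩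
    · intro u hu
      by_contra huS
      have c1 := coatom_mem_of_notMem h₁ hS1 huS
      rcases Finset.mem_union.1 (Finset.mem_coe.1 hu) with h | h
      · exact ((hm u).2.1.1 h).2.1 c1
      · exact ((hm u).2.2.1 h).2.1 c1
    · simp only [Set.mem_union, Set.mem_inter_iff]; tauto
  have pet3 : ((G₂ ∪ G₃) ∩ (G₁ ∪ G₃)) \ (G₁ ∪ G₂) ⊆ contain (PA ∪ PB) \ contain R := by
    rw [e3]
    intro S hS
    have hS3 : S ∈ G₃ := hS.1
    have hS1 : S ∉ G₁ := fun h => hS.2 (Or.inl h)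
    have hS2 : S ∉ G₂ := fun h => hS.2 (Or.inr h)
    refine ⟨?_, notcore S ?_⟩
    · intro u hu
      by_contra huS
      have c3 := coatom_mem_of_notMem h₃ hS3 huS
      rcases Finset.mem_union.1 (Finset.mem_coe.1 hu) with h | h
      · exact ((hm u).1.1 h).2 c3
      · exact ((hm u).2.1.1 h).2.2 c3
    · simp only [Set.mem_union, Set.mem_inter_iff]; tauto
  have env : ∀ X : Finset ι, X ⊆ R → m⟦p, contain X \ contain R⟧ = (∏ u ∈ X, (p u : ℝ)) - a * b * c := by
    intro X hX; rw [m_sdiff₃ p (contain_mono hX), m_contain, m_contain, hprodR]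
  have subAC : PA ∪ PC ⊆ R := Finset.union_subset (Finset.subset_union_left.trans Finset.subset_union_left) Finset.subset_union_right
  have subBC : PB ∪ PC ⊆ R := Finset.union_subset (Finset.subset_union_right.trans Finset.subset_union_left) Finset.subset_union_right
  have subAB : PA ∪ PB ⊆ R := Finset.subset_union_left
  have hα : m⟦p, (G₂ ∪ G₃) \ (G₁ ∪ G₃)⟧ ≤ a * c - a * b * c := by
    refine le_trans (m_mono₃ p pet1) ?_; rw [env _ subAC, Finset.prod_union dAC]
  have hβ : m⟦p, (G₁ ∪ G₃) \ (G₂ ∪ G₃)⟧ ≤ b * c - a * b * c := by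
    refine le_trans (m_mono₃ p pet2) ?_; rw [env _ subBC, Finset.prod_union dBC]
  have hd : m⟦p, ((G₂ ∪ G₃) ∩ (G₁ ∪ G₃)) \ (G₁ ∪ G₂)⟧ ≤ a * b - a * b * c := by
    refine le_trans (m_mono₃ p pet3) ?_; rw [env _ subAB, Finset.prod_union dAB]
  -- expand `strongCubic` and transfer at fixed core
  have hs := cells_sum_eq_one p (G₂ ∪ G₃) (G₁ ∪ G₃) (G₁ ∪ G₂)
  have ho : m⟦p, ((G₂ ∪ G₃) ∪ (G₁ ∪ G₃))ᶜ⟧ = 1 - a * b * c - m⟦p, (G₂ ∪ G₃) \ (G₁ ∪ G₃)⟧ - m⟦p, (G₁ ∪ G₃) \ (G₂ ∪ G₃)⟧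
      - m⟦p, ((G₂ ∪ G₃) ∩ (G₁ ∪ G₃)) \ (G₁ ∪ G₂)⟧ := by linarith
  simp only [strongCubic]
  rw [hk, ho]
  set x := m⟦p, (G₂ ∪ G₃) \ (G₁ ∪ G₃)⟧
  set y := m⟦p, (G₁ ∪ G₃) \ (G₂ ∪ G₃)⟧
  set z := m⟦p, ((G₂ ∪ G₃) ∩ (G₁ ∪ G₃)) \ (G₁ ∪ G₂)⟧
  have hx0 : 0 ≤ x := m_nn₃ p _
  have hy0 : 0 ≤ y := m_nn₃ p _
  have hz0 : 0 ≤ z := m_nn₃ p _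
  obtain ⟨ha0, ha1⟩ := prod_coe_mem p PA
  obtain ⟨hb0, hb1⟩ := prod_coe_mem p PB
  obtain ⟨hc0, hc1⟩ := prod_coe_mem p PC
  set k := a * b * c with hkdef
  have hk0 : 0 ≤ k := mul_nonneg (mul_nonneg ha0 hb0) hc0
  set x' := a * c - k
  set y' := b * c - k
  set z' := a * b - k
  have hy' : 0 ≤ y' := le_trans hy0 hβ
  have hz' : 0 ≤ z' := le_trans hz0 hd
  have s1 : k * (1 - k - x - y - z') - (x * y + x * z' + y * z') - x * y * z'
      ≤ k * (1 - k - x - y - z) - (x * y + x * z + y * z) - x * y * z := by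
    nlinarith [mul_nonneg (sub_nonneg.2 hd) (add_nonneg (add_nonneg (add_nonneg hk0 hx0) hy0) (mul_nonneg hx0 hy0))]
  have s2 : k * (1 - k - x - y' - z') - (x * y' + x * z' + y' * z') - x * y' * z'
      ≤ k * (1 - k - x - y - z') - (x * y + x * z' + y * z') - x * y * z' := by
    nlinarith [mul_nonneg (sub_nonneg.2 hβ) (add_nonneg (add_nonneg (add_nonneg hk0 hx0) hz') (mul_nonneg hx0 hz'))]
  have s3 : k * (1 - k - x' - y' - z') - (x' * y' + x' * z' + y' * z') - x' * y' * z'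
      ≤ k * (1 - k - x - y' - z') - (x * y' + x * z' + y' * z') - x * y' * z' := by
    nlinarith [mul_nonneg (sub_nonneg.2 hα) (add_nonneg (add_nonneg (add_nonneg hk0 hy') hz') (mul_nonneg hy' hz'))]
  have val : k * (1 - k - x' - y' - z') - (x' * y' + x' * z' + y' * z') - x' * y' * z'
      = a * b * c * ((1 - a) * (1 - b) * (1 - c)) * (1 - a * b * c) := by
    simp only [x', y', z', hkdef]; ring
  linarith

/-- **COROLLARY (S₃ and the class law on the "majority = AND-event" stratum).**  Under the hypotheses of `strongCubic_ge_of_majAnd`: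
`0 ≤ F_S ≤ E₃(μ_p; 1_{G₂∪G₃}, 1_{G₁∪G₃}, 1_{G₁∪G₂})`; contains `coSunflower_nonneg_of_separated` (`R = univ`). [this work] -/
theorem coSunflower_nonneg_of_majAnd (p : ι → unitInterval) {G₁ G₂ G₃ : Set (Set ι)} (h₁ : IsUpperSet G₁) (h₂ : IsUpperSet G₂)
    (h₃ : IsUpperSet G₃)
    (hcogen : ∀ S : Set ι, S ∉ (G₁ ∩ G₂) ∪ (G₁ ∩ G₃) ∪ (G₂ ∩ G₃) →
      ∃ u, u ∉ S ∧ ({u}ᶜ : Set ι) ∉ (G₁ ∩ G₂) ∪ (G₁ ∩ G₃) ∪ (G₂ ∩ G₃)) :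
    0 ≤ strongCubic p (G₂ ∪ G₃) (G₁ ∪ G₃) (G₁ ∪ G₂) ∧
      0 ≤ sahiE (bernoulliWeight p) 3 ![ind (G₂ ∪ G₃), ind (G₁ ∪ G₃), ind (G₁ ∪ G₂)] := by
  have hF := strongCubic_ge_of_majAnd p h₁ h₂ h₃ hcogen
  obtain ⟨ha0, ha1⟩ := prod_coe_mem p (rgrpA G₂ G₃)
  obtain ⟨hb0, hb1⟩ := prod_coe_mem p (rgrpB G₁ G₂ G₃)
  obtain ⟨hc0, hc1⟩ := prod_coe_mem p (rgrpC G₁ G₂ G₃)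
  have h3 : (∏ u ∈ rgrpA G₂ G₃, (p u : ℝ)) * (∏ u ∈ rgrpB G₁ G₂ G₃, (p u : ℝ)) * (∏ u ∈ rgrpC G₁ G₂ G₃, (p u : ℝ)) ≤ 1 := by
    calc (∏ u ∈ rgrpA G₂ G₃, (p u : ℝ)) * (∏ u ∈ rgrpB G₁ G₂ G₃, (p u : ℝ)) * (∏ u ∈ rgrpC G₁ G₂ G₃, (p u : ℝ))
        ≤ 1 * 1 * 1 := by gcongr
      _ = 1 := by ring
  have hlow : 0 ≤ (∏ u ∈ rgrpA G₂ G₃, (p u : ℝ)) * (∏ u ∈ rgrpB G₁ G₂ G₃, (p u : ℝ)) * (∏ u ∈ rgrpC G₁ G₂ G₃, (p u : ℝ)) *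
        ((1 - ∏ u ∈ rgrpA G₂ G₃, (p u : ℝ)) * (1 - ∏ u ∈ rgrpB G₁ G₂ G₃, (p u : ℝ)) * (1 - ∏ u ∈ rgrpC G₁ G₂ G₃, (p u : ℝ))) *
        (1 - (∏ u ∈ rgrpA G₂ G₃, (p u : ℝ)) * (∏ u ∈ rgrpB G₁ G₂ G₃, (p u : ℝ)) * (∏ u ∈ rgrpC G₁ G₂ G₃, (p u : ℝ))) :=
    mul_nonneg (mul_nonneg (mul_nonneg (mul_nonneg ha0 hb0) hc0)
      (mul_nonneg (mul_nonneg (sub_nonneg.2 ha1) (sub_nonneg.2 hb1)) (sub_nonneg.2 hc1))) (sub_nonneg.2 h3)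
  have hS : 0 ≤ strongCubic p (G₂ ∪ G₃) (G₁ ∪ G₃) (G₁ ∪ G₂) := le_trans hlow hF
  obtain ⟨s1, s2, s3⟩ := coSunflower_sandwich G₁ G₂ G₃
  exact ⟨hS, le_trans hS (sahiE_three_ge_strongCubic p (h₂.union h₃) (h₁.union h₃) (h₁.union h₂) s1 s2 s3)⟩

end SahiDeepCore

end Summit.CriticalPhenomena.PercolationContinuityZ3.Theorems
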